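import Mathlib
import HarnessLib
import Summits.Ventures.LatticeQCDFlow.Exactness.PairKickPolar

/-!
# The spreading inequality: one SU(2)-pair kick of the uniform law of a coordinate sub-sphere dominates the uniform law of the sub-sphere with one more coordinate

HONEST FRAMING: exact (Metropolis-corrected) sampling algorithms for lattice gauge theory;
figures of merit are autocorrelation/cost numbers at stated couplings and volumes; no
continuum-physics claim.

Venture `LatticeQCDFlow` (cell pub-lqcd), topic `Exactness`, FANOUT row 9 (eng-latcore, the
engine `latflow.core`; `update_link` in `csrc/latcore_template.c` runs one Cabibbo–Marinari
heat-bath hit per coordinate pair).  NEW WORK of the cell over Mathlib and row 9's earlier files;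
nothing is cited as a fact.  Part of the proof that the SU(N ≥ 3) Cabibbo–Marinari heat bath is
uniformly ergodic (the convolution of the SU(2)-pair Haar measures dominates Haar on `SU(N)`).

## What is proved (`n` a finite nonempty index type, `E n = ℝ^{n ⊕ n} ≅ ℂ^n`, `S n` its unit sphere)

* `measure_smul_le_smul_of_le`, `map_shuffle_prod`, `prod_map_right_eq_map_prodMap` (bookkeeping);
  `chiMeasure m = r^m e^{−r²/2} dr|_{(0,∞)}`; `ofReal_cube_gauss_le`;
  **`chiMeasure_three_map_half_le`** — `(χ₄-type radius)/2` is dominated by `16 ×` the `χ₂`-type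
  radius (density `16 u³ e^{−2u²} ≤ 16 u e^{−u²/2}`); `radLaw_eq_smul_chiMeasure`;
  **`radLaw_pair_map_half_le`** — `(radLaw {a,b}).map (·/2) ≤ C · radLaw {a}`, `C < ∞`.
* **`subLaw_insert_le`** (STEP) — for `i ∈ s'`, `j ∉ s'` there is `C < ∞` with
  `subLaw (insert j s') ≤ C • ((pairLaw i j) ⊗ (subLaw s')).map (g, σ) ↦ g • σ`.  Proof (scaling
  trick, no Beta integrals): the direction of a vector is unchanged by halving it; halving the
  Gaussian `(s' − i)`-block costs `2^{2N}` (`stdGaussian_map_smul_le`), and the halved Gaussian pair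
  block `(i, j)` is dominated by the kicked single block `i` (both are `length × uniform direction
  on the pair sphere`, lengths compared by `radLaw_pair_map_half_le`); independence of the blocks
  (`stdGaussian_map_projE_pair`) glues the two comparisons.

NOT CLAIMED: any sharp constant (the argument gives `2^{2N} · C`; the sharp constant would be the number of old coordinates).
-/

namespace Summit.Ventures.LatticeQCDFlow.Exactness

open Matrix MeasureTheory WithLp Metric Complex ProbabilityTheory Measure Set
open scoped ENNReal

variable {n : Type*} [Fintype n] [DecidableEq n]

/-! ## §4 The radial comparison and the spreading inequality -/

section Spreading

variable [Nonempty n]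

omit [Fintype n] [DecidableEq n] [Nonempty n] in
/-- Scalar multiples of measures are monotone. -/
theorem measure_smul_le_smul_of_le {α : Type*} [MeasurableSpace α] {μ ν : Measure α} (h : μ ≤ ν) (c : ℝ≥0∞) :
    c • μ ≤ c • ν := by
  refine Measure.le_iff.2 fun t ht => ?_
  rw [Measure.smul_apply, Measure.smul_apply, smul_eq_mul, smul_eq_mul]
  exact mul_le_mul_right (Measure.le_iff'.1 h t) _

omit [Fintype n] [DecidableEq n] [Nonempty n] in
/-- Reshuffling a triple product: `(h, (u, v)) ↦ (u, (h, v))` sends `μ ⊗ (ν ⊗ τ)` to `ν ⊗ (μ ⊗ τ)`. -/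
theorem map_shuffle_prod {α β γ : Type*} [MeasurableSpace α] [MeasurableSpace β] [MeasurableSpace γ]
    (μ : Measure α) (ν : Measure β) (τ : Measure γ) [SFinite μ] [SFinite ν] [SFinite τ] :
    (μ.prod (ν.prod τ)).map (fun q : α × (β × γ) => (q.2.1, (q.1, q.2.2))) = ν.prod (μ.prod τ) := by
  have hσ : (fun q : α × (β × γ) => (q.2.1, (q.1, q.2.2))) =
      (MeasurableEquiv.prodAssoc : (β × α) × γ ≃ᵐ β × (α × γ)) ∘ (Prod.map Prod.swap id) ∘
        ((MeasurableEquiv.prodAssoc : (α × β) × γ ≃ᵐ α × (β × γ)).symm) := by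
    funext q; rfl
  rw [hσ, ← Measure.map_map (MeasurableEquiv.measurable _) ((measurable_swap.prodMap measurable_id).comp
      (MeasurableEquiv.measurable _)),
    ← Measure.map_map (measurable_swap.prodMap measurable_id) (MeasurableEquiv.measurable _)]
  have h1 : (μ.prod (ν.prod τ)).map ((MeasurableEquiv.prodAssoc : (α × β) × γ ≃ᵐ α × (β × γ)).symm) =
      (μ.prod ν).prod τ := by
    rw [← Measure.prodAssoc_prod, Measure.map_map (MeasurableEquiv.measurable _) (MeasurableEquiv.measurable _)]
    simp
  rw [h1, ← Measure.map_prod_map _ _ measurable_swap measurable_id, Measure.prod_swap, Measure.map_id,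
    Measure.prodAssoc_prod]

omit [Fintype n] [DecidableEq n] [Nonempty n] in
/-- Mapping the second factor of a product measure. -/
theorem prod_map_right_eq_map_prodMap {α β γ : Type*} [MeasurableSpace α] [MeasurableSpace β] [MeasurableSpace γ]
    (μ : Measure α) (ν : Measure β) [SFinite μ] [SFinite ν] {g : β → γ} (hg : Measurable g) :
    μ.prod (ν.map g) = (μ.prod ν).map (Prod.map id g) := by
  rw [← Measure.map_prod_map μ ν measurable_id hg, Measure.map_id]

/-- The chi-type reference measures `r^m e^{−r²/2} dr` on `(0, ∞)`. -/
noncomputable def chiMeasure (m : ℕ) : Measure ℝ :=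
  (volume.restrict (Ioi (0 : ℝ))).withDensity (fun r => ENNReal.ofReal (r ^ m * Real.exp (-r ^ 2 / 2)))

omit [Fintype n] [DecidableEq n] [Nonempty n] in
/-- The pointwise density bound `(2u)³ e^{−2u²} ≤ 8 u e^{−u²/2}` (as extended reals, all real `u`). -/
theorem ofReal_cube_gauss_le (u : ℝ) :
    ENNReal.ofReal ((2 * u) ^ 3 * Real.exp (-(2 * u) ^ 2 / 2)) ≤
      8 * ENNReal.ofReal (u ^ 1 * Real.exp (-u ^ 2 / 2)) := by
  by_cases hu : 0 < u
  · rw [← ENNReal.ofReal_ofNat 8, ← ENNReal.ofReal_mul (by norm_num)]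
    refine ENNReal.ofReal_le_ofReal ?_
    have h1 : u ^ 2 ≤ Real.exp (3 * u ^ 2 / 2) := by
      have := Real.add_one_le_exp (3 * u ^ 2 / 2); nlinarith [sq_nonneg u]
    have h2 : u ^ 2 * Real.exp (-2 * u ^ 2) ≤ Real.exp (-u ^ 2 / 2) := by
      calc u ^ 2 * Real.exp (-2 * u ^ 2) ≤ Real.exp (3 * u ^ 2 / 2) * Real.exp (-2 * u ^ 2) :=
            mul_le_mul_of_nonneg_right h1 (Real.exp_pos _).le
        _ = Real.exp (-u ^ 2 / 2) := by rw [← Real.exp_add]; ring_nf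
    have h3 : -(2 * u) ^ 2 / 2 = -2 * u ^ 2 := by ring
    rw [h3]
    calc (2 * u) ^ 3 * Real.exp (-2 * u ^ 2) = 8 * u * (u ^ 2 * Real.exp (-2 * u ^ 2)) := by ring
      _ ≤ 8 * u * Real.exp (-u ^ 2 / 2) := mul_le_mul_of_nonneg_left h2 (by positivity)
      _ = 8 * (u ^ 1 * Real.exp (-u ^ 2 / 2)) := by ring
  · have hle : (2 * u) ^ 3 * Real.exp (-(2 * u) ^ 2 / 2) ≤ 0 := by
      have : (2 * u) ^ 3 ≤ 0 := by
        have hu' : 2 * u ≤ 0 := by linarith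
        nlinarith [sq_nonneg (2 * u)]
      exact mul_nonpos_of_nonpos_of_nonneg this (Real.exp_pos _).le
    rw [ENNReal.ofReal_of_nonpos hle]
    exact zero_le

omit [Fintype n] [DecidableEq n] [Nonempty n] in
/-- **Halving a `χ₄`-type radius is dominated by a `χ₂`-type radius**:
`(r³ e^{−r²/2} dr).map (r ↦ r/2) ≤ 16 · (r e^{−r²/2} dr)` (density `16 u³ e^{−2u²} ≤ 16 u e^{−u²/2}`). -/
theorem chiMeasure_three_map_half_le :
    (chiMeasure 3).map (fun r => (1 / 2 : ℝ) * r) ≤ (ENNReal.ofReal |(1 / 2 : ℝ)⁻¹| * 8) • chiMeasure 1 := by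
  have hhalf : (1 / 2 : ℝ) ≠ 0 := by norm_num
  set e : ℝ ≃ᵐ ℝ := (Homeomorph.mulLeft₀ (1 / 2 : ℝ) hhalf).toMeasurableEquiv with he
  have hecoe : (e : ℝ → ℝ) = fun r => (1 / 2 : ℝ) * r := rfl
  have hsymm : ∀ r, e.symm r = 2 * r := fun r => by
    apply e.injective
    rw [e.apply_symm_apply, hecoe]
    ring
  set ψ₃ : ℝ → ℝ≥0∞ := fun r => ENNReal.ofReal (r ^ 3 * Real.exp (-r ^ 2 / 2)) with hψ₃
  have hψ₃m : Measurable ψ₃ := by fun_prop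
  have hψ₁m : Measurable fun r : ℝ => ENNReal.ofReal (r ^ 1 * Real.exp (-r ^ 2 / 2)) := by fun_prop
  have hpre : e ⁻¹' Ioi 0 = Ioi 0 := by
    ext r
    simp only [mem_preimage, mem_Ioi, hecoe]
    constructor <;> intro h <;> linarith
  -- push the density through the dilation
  have h1 : (chiMeasure 3).map (fun r => (1 / 2 : ℝ) * r) =
      ENNReal.ofReal |(1 / 2 : ℝ)⁻¹| • (volume.restrict (Ioi (0 : ℝ))).withDensity (ψ₃ ∘ e.symm) := by
    have hfe : ψ₃ = (ψ₃ ∘ e.symm) ∘ e := by funext r; simp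
    rw [chiMeasure, ← hecoe]
    change ((volume.restrict (Ioi (0 : ℝ))).withDensity ψ₃).map e = _
    rw [hfe, map_withDensity_equiv _ e (hψ₃m.comp e.symm.measurable), ← hfe]
    have hres : (volume.restrict (Ioi (0 : ℝ))).map e =
        ENNReal.ofReal |(1 / 2 : ℝ)⁻¹| • volume.restrict (Ioi 0) := by
      conv_lhs => rw [← hpre]
      rw [← e.measurableEmbedding.restrict_map volume (Ioi 0), hecoe, Real.map_volume_mul_left hhalf,
        Measure.restrict_smul]
    rw [hres, withDensity_smul_measure]
  have hmono : (volume.restrict (Ioi (0 : ℝ))).withDensity (ψ₃ ∘ e.symm) ≤ (8 : ℝ≥0∞) • chiMeasure 1 := by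
    rw [chiMeasure, ← withDensity_smul _ hψ₁m]
    refine withDensity_mono (ae_of_all _ fun u => ?_)
    rw [Function.comp_apply, hsymm, Pi.smul_apply, smul_eq_mul]
    change ENNReal.ofReal ((2 * u) ^ 3 * Real.exp (-(2 * u) ^ 2 / 2)) ≤
      8 * ENNReal.ofReal (u ^ 1 * Real.exp (-u ^ 2 / 2))
    exact ofReal_cube_gauss_le u
  rw [h1, ← smul_smul]
  exact measure_smul_le_smul_of_le hmono _

omit [Nonempty n] in
/-- The radial law of a Gaussian block is a chi-type measure, up to a positive finite constant. -/
theorem radLaw_eq_smul_chiMeasure (s : Finset n) (hs : s.Nonempty) :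
    ∃ K : ℝ≥0∞, K ≠ 0 ∧ K ≠ ∞ ∧ radLaw s = K • chiMeasure (2 * s.card - 1) := by
  refine ⟨_, chiConst_ne_zero s hs, chiConst_ne_top s, ?_⟩
  rw [radLaw, chiMeasure]
  exact stdGaussian_map_norm_projE s hs

omit [Nonempty n] in
/-- **The radial comparison**: halving the length of the Gaussian pair block `{a, b}` is dominated by
a constant times the length law of the single block `{a}`. -/
theorem radLaw_pair_map_half_le (a b : n) (hab : a ≠ b) :
    ∃ C : ℝ≥0∞, C ≠ ∞ ∧
      (radLaw ({a, b} : Finset n)).map (fun r => (1 / 2 : ℝ) * r) ≤ C • radLaw ({a} : Finset n) := by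
  obtain ⟨KQ, -, hKQt, hQ⟩ := radLaw_eq_smul_chiMeasure ({a, b} : Finset n) (Finset.insert_nonempty a {b})
  obtain ⟨Ka, hKa0, hKat, ha⟩ := radLaw_eq_smul_chiMeasure ({a} : Finset n) (Finset.singleton_nonempty a)
  rw [Finset.card_pair hab] at hQ
  rw [Finset.card_singleton] at ha
  norm_num at hQ ha
  refine ⟨KQ * (ENNReal.ofReal |(1 / 2 : ℝ)⁻¹| * 8) * Ka⁻¹,
    ENNReal.mul_ne_top (ENNReal.mul_ne_top hKQt (ENNReal.mul_ne_top ENNReal.ofReal_ne_top (by norm_num)))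
      (ENNReal.inv_ne_top.2 hKa0), ?_⟩
  rw [hQ, Measure.map_smul, ha, smul_smul, mul_assoc (KQ * _), ENNReal.inv_mul_cancel hKa0 hKat, mul_one,
    ← smul_smul]
  exact measure_smul_le_smul_of_le chiMeasure_three_map_half_le _


/-- **The spreading inequality (STEP).**  For `i ∈ s'`, `j ∉ s'`: the uniform law of the sub-sphere
of `s' ∪ {j}` is dominated by a constant times the law obtained by kicking the uniform law of the
sub-sphere of `s'` with the Haar-distributed SU(2) element of the pair `(i, j)`:
`subLaw (insert j s') ≤ C • (pairLaw i j ⊗ subLaw s').map (g, σ) ↦ g • σ`, `C < ∞`. -/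
theorem subLaw_insert_le (s' : Finset n) {i j : n} (hi : i ∈ s') (hj : j ∉ s') :
    ∃ C : ℝ≥0∞, C ≠ ∞ ∧ subLaw (insert j s') ≤
      C • ((pairLaw i j (ne_of_mem_of_not_mem hi hj)).prod (subLaw s')).map (fun p => actSU p.1 p.2) := by
  have hij : i ≠ j := ne_of_mem_of_not_mem hi hj
  have hs'ne : s'.Nonempty := ⟨i, hi⟩
  -- coordinate bookkeeping: `insert j s' = R ∪ {i, j}`, `s' = R ∪ {i}`, `R = s' \ {i}`
  set R : Finset n := s'.erase i with hR
  have hiR : i ∉ R := Finset.notMem_erase i s'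
  have hjR : j ∉ R := fun h => hj (Finset.mem_of_mem_erase h)
  have hRQ : Disjoint R ({i, j} : Finset n) := by
    rw [Finset.disjoint_insert_right, Finset.disjoint_singleton_right]; exact ⟨hiR, hjR⟩
  have hRi : Disjoint R ({i} : Finset n) := Finset.disjoint_singleton_right.2 hiR
  have hRQu : R ∪ {i, j} = insert j s' := by
    ext x
    simp only [hR, Finset.mem_union, Finset.mem_erase, Finset.mem_insert, Finset.mem_singleton]
    constructor
    · rintro (⟨-, hx⟩ | rfl | rfl)
      · exact Or.inr hx
      · exact Or.inr hi
      · exact Or.inl rfl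
    · rintro (rfl | hx)
      · exact Or.inr (Or.inr rfl)
      · by_cases hxi : x = i
        · exact Or.inr (Or.inl hxi)
        · exact Or.inl ⟨hxi, hx⟩
  have hRiu : R ∪ {i} = s' := by
    rw [hR, Finset.union_comm, ← Finset.insert_eq, Finset.insert_erase hi]
  -- constants
  obtain ⟨C₁, hC₁, hrad⟩ := radLaw_pair_map_half_le i j hij
  set K₀ : ℝ≥0∞ := ENNReal.ofReal |((1 / 2 : ℝ) ^ Module.finrank ℝ (E n))⁻¹| with hK₀
  refine ⟨K₀ * C₁, ENNReal.mul_ne_top ENNReal.ofReal_ne_top hC₁, ?_⟩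
  -- abbreviations
  set γ : Measure (E n) := stdGaussian (E n) with hγ
  set φ := pairHom i j hij with hφ
  set Λc : Measure (E n) := (haarSU2.prod (γ.map (projE {i}))).map (pairKick i j hij) with hΛc
  have hhalf : (0 : ℝ) < 1 / 2 := by norm_num
  have hsmul : Measurable fun x : E n => (1 / 2 : ℝ) • x := measurable_const_smul _
  have hadd : Measurable fun q : E n × E n => q.1 + q.2 := measurable_fst.add measurable_snd
  have hact : Measurable fun p : Matrix.specialUnitaryGroup n ℂ × S n => actSU p.1 p.2 :=
    continuous_actSU.measurable
  haveI : IsFiniteMeasure Λc := Measure.isFiniteMeasure_map _ _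
  -- (1) the target side as a sum of two independent halved blocks
  have hT : subLaw (insert j s') =
      ((((γ.map (projE R)).map (fun x => (1 / 2 : ℝ) • x)).prod
        ((γ.map (projE {i, j})).map (fun x => (1 / 2 : ℝ) • x))).map (fun q : E n × E n => q.1 + q.2)).map
          dirSphere := by
    have hfun : (fun x : E n => dirSphere (projE (insert j s') x)) =
        dirSphere ∘ (fun q : E n × E n => q.1 + q.2) ∘
          (Prod.map (fun x : E n => (1 / 2 : ℝ) • x) (fun x : E n => (1 / 2 : ℝ) • x)) ∘
            (fun x => (projE R x, projE {i, j} x)) := by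
      funext x
      change dirSphere (projE (insert j s') x) =
        dirSphere ((1 / 2 : ℝ) • projE R x + (1 / 2 : ℝ) • projE {i, j} x)
      rw [← smul_add, projE_add_projE hRQ, hRQu, dirSphere_smul hhalf]
    rw [subLaw, ← hγ, hfun, ← Measure.map_map measurable_dirSphere (hadd.comp ((hsmul.prodMap hsmul).comp
        ((measurable_projE R).prodMk (measurable_projE _)))),
      ← Measure.map_map hadd ((hsmul.prodMap hsmul).comp ((measurable_projE R).prodMk (measurable_projE _))),
      ← Measure.map_map (hsmul.prodMap hsmul) ((measurable_projE R).prodMk (measurable_projE _)),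
      hγ, stdGaussian_map_projE_pair hRQ,
      ← Measure.map_prod_map _ _ hsmul hsmul]
  -- (2) the kicked side as a sum of the untouched block and the kicked block
  have hC : ((pairLaw i j hij).prod (subLaw s')).map (fun p => actSU p.1 p.2) =
      (((γ.map (projE R)).prod Λc).map (fun q : E n × E n => q.1 + q.2)).map dirSphere := by
    have hG : Measurable fun p : Matrix.specialUnitaryGroup (Fin 2) ℂ × E n =>
        projE R p.2 + pairKick i j hij (p.1, projE {i} p.2) :=
      ((measurable_projE R).comp measurable_snd).add ((measurable_pairKick i j hij).comp
        (measurable_fst.prodMk ((measurable_projE _).comp measurable_snd)))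
    -- left: push η ⊗ γ forward
    have hL : ((pairLaw i j hij).prod (subLaw s')).map (fun p => actSU p.1 p.2) =
        (haarSU2.prod γ).map (fun p => actSU (φ p.1) (dirSphere (projE s' p.2))) := by
      rw [pairLaw, subLaw, ← hγ, ← hφ, Measure.map_prod_map _ _ (measurable_pairHom i j hij)
        (measurable_dirSphere_projE s'), Measure.map_map hact ((measurable_pairHom i j hij).prodMap
        (measurable_dirSphere_projE s'))]
      rfl
    -- a.e. the kick acts on `p_{s'} x = p_R x + p_i x` by fixing the first and kicking the second
    have hae : (fun p : Matrix.specialUnitaryGroup (Fin 2) ℂ × E n => actSU (φ p.1) (dirSphere (projE s' p.2)))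
        =ᵐ[haarSU2.prod γ] dirSphere ∘ (fun p => projE R p.2 + pairKick i j hij (p.1, projE {i} p.2)) := by
      have hnull : (haarSU2.prod γ) {p | projE s' p.2 = 0} = 0 := by
        have hset : {p : Matrix.specialUnitaryGroup (Fin 2) ℂ × E n | projE s' p.2 = 0} =
            (univ : Set (Matrix.specialUnitaryGroup (Fin 2) ℂ)) ×ˢ {x : E n | projE s' x = 0} := by
          ext p; simp
        rw [hset, Measure.prod_prod, hγ, stdGaussian_projE_eq_zero hs'ne, mul_zero]
      filter_upwards [compl_mem_ae_iff.2 hnull] with p hp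
      have hp' : projE s' p.2 ≠ 0 := hp
      change actSU (φ p.1) (dirSphere (projE s' p.2)) = dirSphere (projE R p.2 + pairKick i j hij (p.1, projE {i} p.2))
      rw [← dirSphere_rotC (φ p.1) hp', ← hRiu, ← projE_add_projE hRi, map_add, hφ,
        rotC_eq_self_of_supported (pairHom_mem_coordSubgroup i j hij p.1) (fun c hc =>
          cplx_projE_of_not_mem R p.2 (Finset.disjoint_right.1 hRQ hc))]
      rfl
    rw [hL, Measure.map_congr hae, ← Measure.map_map measurable_dirSphere hG]
    congr 1
    -- the joint law of (untouched block, kicked block)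
    have hfun : (fun p : Matrix.specialUnitaryGroup (Fin 2) ℂ × E n =>
        projE R p.2 + pairKick i j hij (p.1, projE {i} p.2)) =
        ((fun q : E n × (Matrix.specialUnitaryGroup (Fin 2) ℂ × E n) => q.1 + pairKick i j hij q.2) ∘
          (fun q : Matrix.specialUnitaryGroup (Fin 2) ℂ × (E n × E n) => (q.2.1, (q.1, q.2.2)))) ∘
            (Prod.map id (fun x : E n => (projE R x, projE {i} x))) := by
      funext p; rfl
    have hshuf : Measurable fun q : Matrix.specialUnitaryGroup (Fin 2) ℂ × (E n × E n) => (q.2.1, (q.1, q.2.2)) :=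
      (measurable_fst.comp measurable_snd).prodMk (measurable_fst.prodMk (measurable_snd.comp measurable_snd))
    have hlast : Measurable fun q : E n × (Matrix.specialUnitaryGroup (Fin 2) ℂ × E n) => q.1 + pairKick i j hij q.2 :=
      measurable_fst.add ((measurable_pairKick i j hij).comp measurable_snd)
    have hpairm : Measurable fun x : E n => (projE R x, projE {i} x) :=
      (measurable_projE R).prodMk (measurable_projE _)
    rw [hfun, ← Measure.map_map (hlast.comp hshuf) (measurable_id.prodMap hpairm),
      ← Measure.map_prod_map _ _ measurable_id hpairm, Measure.map_id, hγ, stdGaussian_map_projE_pair hRi, ← hγ,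
      ← Measure.map_map hlast hshuf, map_shuffle_prod, hΛc,
      prod_map_right_eq_map_prodMap _ _ (measurable_pairKick i j hij),
      Measure.map_map hadd (measurable_id.prodMap (measurable_pairKick i j hij))]
    rfl
  -- (3) the two block inequalities
  have h1 : (γ.map (projE R)).map (fun x => (1 / 2 : ℝ) • x) ≤ K₀ • γ.map (projE R) := by
    rw [Measure.map_map hsmul (measurable_projE R)]
    have hcomm : (fun x : E n => (1 / 2 : ℝ) • x) ∘ projE R = projE R ∘ (fun x : E n => (1 / 2 : ℝ) • x) := by
      funext x; exact (projE_smul R _ x).symm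
    rw [hcomm, ← Measure.map_map (measurable_projE R) hsmul, ← Measure.map_smul, hγ]
    exact Measure.map_mono (stdGaussian_map_smul_le hhalf (by norm_num)) (measurable_projE R)
  have h2 : (γ.map (projE {i, j})).map (fun x => (1 / 2 : ℝ) • x) ≤ C₁ • Λc := by
    rw [Measure.map_map hsmul (measurable_projE _), hγ]
    change (stdGaussian (E n)).map (fun x => (1 / 2 : ℝ) • projE {i, j} x) ≤ _
    rw [stdGaussian_map_smul_projE_pair i j hij, hΛc, hγ, pairKick_law i j hij, ← Measure.map_smul,
      ← Measure.prod_smul_right]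
    exact Measure.map_mono (Measure.prod_mono le_rfl hrad)
      (measurable_snd.smul (measurable_subtype_coe.comp measurable_fst))
  -- (4) assemble
  rw [hT, hC, ← Measure.map_smul, ← Measure.map_smul, ← smul_smul, ← Measure.prod_smul_right,
    ← Measure.prod_smul_left]
  exact Measure.map_mono (Measure.map_mono (Measure.prod_mono h1 h2) hadd) measurable_dirSphere

end Spreading

end Summit.Ventures.LatticeQCDFlow.Exactness
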